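import Summits.AtomisticToContinuum.Crystallization.Theorems.HullExactificationCascadeRobustBarlowTemplateHoneycombDefs

/-!
# Honeycomb lemmas, part 1 (skew coordinates) for line `registered` (crux `RobustBarlowTemplate`, stmt-AtomisticToContinuum-12088)

Skew-coordinate algebra of the refined Barlow honeycomb (definitions in
`HullExactificationCascadeRobustBarlowTemplateHoneycombDefs.lean`), toward the registered stub
`develop_injective`.

## Contents
* `honeycomb_hB_pos`, `honeycomb_hB_sq`, `honeycomb_sign_mul_self` — numerics of `h = √(2/3)`, `σ = ±1`
  (`(√3)² = 3` is inlined; cf. `Literature.Geometry.DiscreteGeometry.sqrt_three_sq`);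
* `honeycomb_ofSkew_apply_zero/one/two`, `honeycomb_toSkew_apply_two` — coordinates;
* `honeycomb_siteAt_skewSite` — the site with integer skew coordinates `(p, q, r)` of slab `k` is
  `ofSkew s k (p, q, r)` (registered sub-goal);
* `honeycomb_toSkew_ofSkew`, `honeycomb_ofSkew_toSkew` — `toSkew s k` is the two-sided inverse of
  `ofSkew s k`;
* `honeycomb_ofSkew_top` — the frame change across a layer: `ofSkew s k (α, β, 1) =
  ofSkew s (k+1) (τ α, τ β, 0)`, `τ = σ_k σ_{k+1}`;
* `honeycomb_gram`, `honeycomb_sqdist_ofSkew` — the frame is unit with pairwise inner products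
  `1/2`; squared distances in skew coordinates;
* `honeycomb_slabOf_ofSkew`, `honeycomb_slabOf_siteAt`, `honeycomb_plExtend_siteAt` — the slab of a
  point with `θ ∈ [0,1)`, of a site, and `plExtend s g (site t) = g t`.
-/

noncomputable section

namespace Summit.AtomisticToContinuum.Crystallization.Theorems.HullExactificationCascadeRobustBarlowTemplate

open Literature.MathematicalPhysics.StatisticalMechanics
open scoped InnerProductSpace

/-- Euclidean `3`-space. -/
local notation "E3" => EuclideanSpace ℝ (Fin 3)

/-! ## Numerics of the constants -/

/-- `0 < h`. -/
theorem honeycomb_hB_pos : 0 < hB := Real.sqrt_pos.2 (by norm_num)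

/-- `h ≠ 0`. -/
theorem honeycomb_hB_ne_zero : hB ≠ 0 := honeycomb_hB_pos.ne'

/-- `h² = 2/3`. -/
theorem honeycomb_hB_sq : hB ^ 2 = 2 / 3 := Real.sq_sqrt (by norm_num)

/-- `σ σ = 1` for a Hägg letter `σ = ±1`. -/
theorem honeycomb_sign_mul_self {s : ℤ → ℤ} {k : ℤ} (h : s k = 1 ∨ s k = -1) :
    (s k : ℝ) * (s k : ℝ) = 1 := by
  rcases h with h | h <;> simp [h]

/-! ## Coordinates -/

/-- First coordinate of `ofSkew`. -/
theorem honeycomb_ofSkew_apply_zero (s : ℤ → ℤ) (k : ℤ) (c : Fin 3 → ℝ) :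
    ofSkew s k c 0 = haggLabel s k / 2 + s k * (c 0 + c 1 / 2 + c 2 / 2) := by
  simp [ofSkew, slabBase, skewU, skewV, riseVec, triangularVec₁, triangularVec₂, barlowOffset,
    layerNormal]
  ring

/-- Second coordinate of `ofSkew`. -/
theorem honeycomb_ofSkew_apply_one (s : ℤ → ℤ) (k : ℤ) (c : Fin 3 → ℝ) :
    ofSkew s k c 1 = Real.sqrt 3 / 6 * (haggLabel s k + s k * (3 * c 1 + c 2)) := by
  simp [ofSkew, slabBase, skewU, skewV, riseVec, triangularVec₁, triangularVec₂, barlowOffset,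
    layerNormal]
  ring

/-- Third coordinate of `ofSkew`: the height `(k + θ) h`. -/
theorem honeycomb_ofSkew_apply_two (s : ℤ → ℤ) (k : ℤ) (c : Fin 3 → ℝ) :
    ofSkew s k c 2 = (k + c 2) * hB := by
  simp [ofSkew, slabBase, skewU, skewV, riseVec, triangularVec₁, triangularVec₂, barlowOffset,
    layerNormal]
  ring

/-- Third skew coordinate: `θ = x₃ / h - k`. -/
theorem honeycomb_toSkew_apply_two (s : ℤ → ℤ) (k : ℤ) (x : E3) :
    toSkew s k x 2 = x 2 / hB - k := by
  have h := honeycomb_hB_ne_zero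
  simp only [toSkew]
  simp
  field_simp

/-! ## Sites in skew coordinates -/

/-- SUB-GOAL (registered): the site of slab `k` with integer skew coordinates `(p, q, r)`,
`r ∈ {0, 1}`, is the point `ofSkew s k (p, q, r)`. -/
theorem honeycomb_siteAt_skewSite :
    ∀ (s : ℤ → ℤ) (k p q r : ℤ), (r = 0 ∨ r = 1) → IsHaggSeq s →
      siteAt s (skewSite s k p q r) = ofSkew s k ![(p : ℝ), (q : ℝ), (r : ℝ)] := by
  intro s k p q r hr _hs
  have hL : (haggLabel s (k + r) : ℝ) = haggLabel s k + r * s k := by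
    rcases hr with rfl | rfl
    · simp
    · rw [haggLabel_succ]; push_cast; ring
  ext n
  fin_cases n
  · simp [siteAt, skewSite, honeycomb_ofSkew_apply_zero, hL]
    ring
  · simp [siteAt, skewSite, honeycomb_ofSkew_apply_one, hL]
    ring
  · simp [siteAt, skewSite, honeycomb_ofSkew_apply_two]

/-! ## `toSkew` and `ofSkew` are mutually inverse -/

/-- `toSkew s k ∘ ofSkew s k = id` (for a Hägg letter `σ_k = ±1`). -/
theorem honeycomb_toSkew_ofSkew :
    ∀ (s : ℤ → ℤ) (k : ℤ), (s k = 1 ∨ s k = -1) → ∀ c : Fin 3 → ℝ, toSkew s k (ofSkew s k c) = c := by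
  intro s k hsk c
  have hh := honeycomb_hB_ne_zero
  have h3 : Real.sqrt 3 ≠ 0 := Real.sqrt_ne_zero'.2 (by norm_num)
  have h3sq : Real.sqrt 3 ^ 2 = 3 := Real.sq_sqrt (by norm_num)
  have hσ := honeycomb_sign_mul_self hsk
  have hθ : (ofSkew s k c 2 - k * hB) / hB = c 2 := by
    rw [honeycomb_ofSkew_apply_two]; field_simp; ring
  funext n
  fin_cases n
  · simp only [toSkew, hθ]
    simp [honeycomb_ofSkew_apply_zero, honeycomb_ofSkew_apply_one, slabBase, riseVec, barlowOffset,
      layerNormal]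
    field_simp
    linear_combination (36 * c 0) * hσ
  · simp only [toSkew, hθ]
    simp [honeycomb_ofSkew_apply_one, slabBase, riseVec, barlowOffset, layerNormal]
    field_simp
    linear_combination (18 * c 1) * hσ
  · simp only [toSkew, hθ]
    simp

/-- `ofSkew s k ∘ toSkew s k = id` (for a Hägg letter `σ_k = ±1`). -/
theorem honeycomb_ofSkew_toSkew :
    ∀ (s : ℤ → ℤ) (k : ℤ), (s k = 1 ∨ s k = -1) → ∀ x : E3, ofSkew s k (toSkew s k x) = x := by
  intro s k hsk x
  have hh := honeycomb_hB_ne_zero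
  have h3 : Real.sqrt 3 ≠ 0 := Real.sqrt_ne_zero'.2 (by norm_num)
  have h3sq : Real.sqrt 3 ^ 2 = 3 := Real.sq_sqrt (by norm_num)
  have hσ := honeycomb_sign_mul_self hsk
  ext n
  fin_cases n
  · simp [honeycomb_ofSkew_apply_zero, toSkew, slabBase, riseVec, barlowOffset, layerNormal]
    field_simp
    linear_combination (-(haggLabel s k) * hB + 2 * hB * x 0 + hB * (s k) * k - (s k) * x 2) * hσ
  · simp [honeycomb_ofSkew_apply_one, toSkew, slabBase, riseVec, barlowOffset, layerNormal]
    field_simp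
    linear_combination (-6 * Real.sqrt 3 * (haggLabel s k) * hB + 6 * Real.sqrt 3 * hB * (s k) * k
      - 6 * Real.sqrt 3 * (s k) * x 2 + 36 * hB * x 1) * hσ
  · simp [honeycomb_ofSkew_apply_two, toSkew]
    field_simp
    ring

/-- The base point of slab `k + 1` is the tip of the rise vector of slab `k`. -/
theorem honeycomb_slabBase_succ (s : ℤ → ℤ) (k : ℤ) :
    slabBase s (k + 1) = slabBase s k + riseVec s k := by
  ext n
  fin_cases n
  · simp [slabBase, riseVec, barlowOffset, layerNormal, haggLabel_succ]
    ring
  · simp [slabBase, riseVec, barlowOffset, layerNormal, haggLabel_succ]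
    ring
  · simp [slabBase, riseVec, barlowOffset, layerNormal]
    ring

/-- FRAME CHANGE across the layer `k + 1`: the point with skew coordinates `(α, β, 1)` in slab `k`
has skew coordinates `(τ α, τ β, 0)` in slab `k + 1`, `τ = σ_k σ_{k+1}`. -/
theorem honeycomb_ofSkew_top (s : ℤ → ℤ) (k : ℤ) (hk : s (k + 1) = 1 ∨ s (k + 1) = -1) (α β : ℝ) :
    ofSkew s k ![α, β, 1] =
      ofSkew s (k + 1) ![(s k : ℝ) * (s (k + 1) : ℝ) * α, (s k : ℝ) * (s (k + 1) : ℝ) * β, 0] := by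
  have hτ := honeycomb_sign_mul_self hk
  simp only [ofSkew, honeycomb_slabBase_succ, skewU, skewV]
  simp only [Matrix.cons_val_zero, Matrix.cons_val_one, Matrix.cons_val, smul_smul, one_smul,
    zero_smul, add_zero]
  have e1 : (s k : ℝ) * (s (k + 1)) * α * (s (k + 1)) = α * (s k) := by
    linear_combination ((s k : ℝ) * α) * hτ
  have e2 : (s k : ℝ) * (s (k + 1)) * β * (s (k + 1)) = β * (s k) := by
    linear_combination ((s k : ℝ) * β) * hτ
  rw [e1, e2]
  abel

/-- The skew-coordinate map of a slab is continuous (it is affine). -/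
theorem honeycomb_continuous_toSkew (s : ℤ → ℤ) (k : ℤ) : Continuous (toSkew s k) := by
  refine continuous_pi fun n => ?_
  fin_cases n <;> simp [toSkew] <;> fun_prop

/-- In the frame of slab `k + 1`, a point with `θ_k = 1` has skew coordinates `(τ α, τ β, 0)`,
`τ = σ_k σ_{k+1}`. -/
theorem honeycomb_toSkew_succ_of_top {s : ℤ → ℤ} (hs : IsHaggSeq s) (k : ℤ) (x : E3)
    (hx : toSkew s k x 2 = 1) :
    toSkew s (k + 1) x =
      ![(s k : ℝ) * (s (k + 1) : ℝ) * toSkew s k x 0, (s k : ℝ) * (s (k + 1) : ℝ) * toSkew s k x 1, 0] := by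
  have e : x = ofSkew s k ![toSkew s k x 0, toSkew s k x 1, 1] := by
    conv_lhs => rw [← honeycomb_ofSkew_toSkew s k (hs k) x]
    congr 1
    funext n
    fin_cases n
    · rfl
    · rfl
    · simpa using hx
  conv_lhs => rw [e, honeycomb_ofSkew_top s k (hs (k + 1)), honeycomb_toSkew_ofSkew s (k + 1) (hs (k + 1))]

/-! ## Metric data of the frame -/

/-- SUB-GOAL: the frame `σu, σv, σw + h e₃` of slab `k` consists of unit vectors with pairwise
inner products `1/2`. -/
theorem honeycomb_gram :
    ∀ (s : ℤ → ℤ) (k : ℤ), (s k = 1 ∨ s k = -1) →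
      ‖skewU s k‖ = 1 ∧ ‖skewV s k‖ = 1 ∧ ‖riseVec s k‖ = 1 ∧
      ⟪skewU s k, skewV s k⟫_ℝ = 1 / 2 ∧ ⟪skewU s k, riseVec s k⟫_ℝ = 1 / 2 ∧
      ⟪skewV s k, riseVec s k⟫_ℝ = 1 / 2 := by
  intro s k hsk
  have h3sq : Real.sqrt 3 ^ 2 = 3 := Real.sq_sqrt (by norm_num)
  have hhsq := honeycomb_hB_sq
  have hn : ∀ v : E3, ‖v‖ ^ 2 = 1 → ‖v‖ = 1 := fun v hv =>
    (pow_eq_one_iff_of_nonneg (norm_nonneg v) two_ne_zero).1 hv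
  refine ⟨hn _ ?_, hn _ ?_, hn _ ?_, ?_, ?_, ?_⟩
  · rw [EuclideanSpace.real_norm_sq_eq, Fin.sum_univ_three]
    rcases hsk with h | h <;> simp [skewU, triangularVec₁, h]
  · rw [EuclideanSpace.real_norm_sq_eq, Fin.sum_univ_three]
    rcases hsk with h | h <;> simp [skewV, triangularVec₂, h] <;> nlinarith [h3sq]
  · rw [EuclideanSpace.real_norm_sq_eq, Fin.sum_univ_three]
    rcases hsk with h | h <;> simp [riseVec, barlowOffset, layerNormal, h] <;> nlinarith [h3sq, hhsq]
  · rw [PiLp.inner_apply, Fin.sum_univ_three]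
    rcases hsk with h | h <;> simp [skewU, skewV, triangularVec₁, triangularVec₂, h]
  · rw [PiLp.inner_apply, Fin.sum_univ_three]
    rcases hsk with h | h <;> simp [skewU, riseVec, triangularVec₁, barlowOffset, layerNormal, h]
  · rw [PiLp.inner_apply, Fin.sum_univ_three]
    rcases hsk with h | h <;> simp [skewV, riseVec, triangularVec₂, barlowOffset, layerNormal, h] <;>
      nlinarith [h3sq]

/-- SUB-GOAL: squared distances in skew coordinates (the Gram form `Σ Δᵢ² + Σ_{i<j} Δᵢ Δⱼ`). -/
theorem honeycomb_sqdist_ofSkew :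
    ∀ (s : ℤ → ℤ) (k : ℤ), (s k = 1 ∨ s k = -1) → ∀ c c' : Fin 3 → ℝ,
      dist (ofSkew s k c) (ofSkew s k c') ^ 2 =
        (c 0 - c' 0) ^ 2 + (c 1 - c' 1) ^ 2 + (c 2 - c' 2) ^ 2 + (c 0 - c' 0) * (c 1 - c' 1) +
          (c 0 - c' 0) * (c 2 - c' 2) + (c 1 - c' 1) * (c 2 - c' 2) := by
  intro s k hsk c c'
  have h3sq : Real.sqrt 3 ^ 2 = 3 := Real.sq_sqrt (by norm_num)
  have hhsq := honeycomb_hB_sq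
  rw [EuclideanSpace.dist_sq_eq, Fin.sum_univ_three, Real.dist_eq, Real.dist_eq, Real.dist_eq, sq_abs,
    sq_abs, sq_abs, honeycomb_ofSkew_apply_zero, honeycomb_ofSkew_apply_zero, honeycomb_ofSkew_apply_one,
    honeycomb_ofSkew_apply_one, honeycomb_ofSkew_apply_two, honeycomb_ofSkew_apply_two]
  rcases hsk with h | h <;> simp only [h] <;> push_cast <;>
    linear_combination ((3 * (c 1 - c' 1) + (c 2 - c' 2)) ^ 2 / 36) * h3sq + (c 2 - c' 2) ^ 2 * hhsq

/-! ## Slabs and point location at sites -/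

/-- The slab of a point with skew coordinates `c` in the frame of slab `k` is `k + ⌊θ⌋`. -/
theorem honeycomb_slabOf_ofSkew (s : ℤ → ℤ) (k : ℤ) (c : Fin 3 → ℝ) :
    slabOf (ofSkew s k c) = k + ⌊c 2⌋ := by
  rw [slabOf, honeycomb_ofSkew_apply_two, mul_div_cancel_right₀ _ honeycomb_hB_ne_zero,
    Int.floor_intCast_add]

/-- SUB-GOAL: the slab of the site `(k, i, j)` is `k`. -/
theorem honeycomb_slabOf_siteAt : ∀ (s : ℤ → ℤ) (t : ℤ × ℤ × ℤ), slabOf (siteAt s t) = t.1 := by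
  intro s t
  rw [slabOf, siteAt, barlowPos_apply_two, mul_div_cancel_right₀ _ honeycomb_hB_ne_zero,
    Int.floor_intCast]

/-- POINT LOCATION IN SKEW COORDINATES: for a point of slab `k` given by its skew coordinates `c`
(`0 ≤ θ < 1`), `plData` is the body of its definition evaluated at `k` and `c`. -/
theorem honeycomb_plData_ofSkew {s : ℤ → ℤ} {k : ℤ} (hsk : s k = 1 ∨ s k = -1) (c : Fin 3 → ℝ)
    (h0 : 0 ≤ c 2) (h1 : c 2 < 1) :
    plData s (ofSkew s k c) =
      (let i : ℤ := ⌊c 0⌋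
      let j : ℤ := ⌊c 1⌋
      let a : ℝ := c 0 - i
      let b : ℝ := c 1 - j
      let θ : ℝ := c 2
      let v : ℤ → ℤ → ℤ → ℤ × ℤ × ℤ := fun p q r => skewSite s k (i + p) (j + q) r
      if a + b + θ ≤ 1 then
        (![v 0 0 0, v 1 0 0, v 0 1 0, v 0 0 1], ![1 - a - b - θ, a, b, θ])
      else if 2 ≤ a + b + θ then
        (![v 1 1 0, v 1 0 1, v 0 1 1, v 1 1 1], ![1 - θ, 1 - b, 1 - a, a + b + θ - 2])
      else if b + θ ≤ 1 then
        (if a + θ ≤ 1 then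
          (![v 1 1 0, v 0 0 1, v 1 0 0, v 0 1 0], ![a + b + θ - 1, θ, 1 - b - θ, 1 - a - θ])
        else
          (![v 1 1 0, v 0 0 1, v 1 0 1, v 1 0 0], ![b, 1 - a, a + θ - 1, 1 - b - θ]))
      else
        (if a + θ ≤ 1 then
          (![v 1 1 0, v 0 0 1, v 0 1 0, v 0 1 1], ![a, 1 - b, 1 - a - θ, b + θ - 1])
        else
          (![v 1 1 0, v 0 0 1, v 0 1 1, v 1 0 1], ![1 - θ, 2 - a - b - θ, b + θ - 1, a + θ - 1]))) := by
  have hfl : ⌊c 2⌋ = 0 := Int.floor_eq_zero_iff.2 ⟨h0, h1⟩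
  simp only [plData]
  rw [honeycomb_slabOf_ofSkew, hfl, add_zero, honeycomb_toSkew_ofSkew s k hsk]

/-- `σ (σ i) = i` in `ℤ` for a Hägg letter. -/
theorem honeycomb_sign_mul_sign_mul {s : ℤ → ℤ} {k : ℤ} (h : s k = 1 ∨ s k = -1) (i : ℤ) :
    s k * (s k * i) = i := by
  rcases h with h | h <;> simp [h]

/-- The site `(k, i, j)` in the skew coordinates of slab `k`: `(σ i, σ j, 0)`. -/
theorem honeycomb_siteAt_eq_ofSkew {s : ℤ → ℤ} (hs : IsHaggSeq s) (k i j : ℤ) :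
    siteAt s (k, i, j) = ofSkew s k ![((s k * i : ℤ) : ℝ), ((s k * j : ℤ) : ℝ), ((0 : ℤ) : ℝ)] := by
  have h := honeycomb_siteAt_skewSite s k (s k * i) (s k * j) 0 (Or.inl rfl) hs
  have e : skewSite s k (s k * i) (s k * j) 0 = (k, i, j) := by
    simp only [skewSite, add_zero, honeycomb_sign_mul_sign_mul (hs k)]
  rwa [e] at h

/-- SUB-GOAL: the piecewise-affine extension interpolates: `plExtend s g (site t) = g t`. -/
theorem honeycomb_plExtend_siteAt :
    ∀ (s : ℤ → ℤ), IsHaggSeq s → ∀ (g : ℤ × ℤ × ℤ → E3) (t : ℤ × ℤ × ℤ),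
      plExtend s g (siteAt s t) = g t := by
  intro s hs g t
  obtain ⟨k, i, j⟩ := t
  have hsk := hs k
  rw [plExtend, honeycomb_siteAt_eq_ofSkew hs,
    honeycomb_plData_ofSkew hsk _ (by simp) (by simp)]
  simp only [Matrix.cons_val_zero, Matrix.cons_val_one, Matrix.cons_val, Int.floor_intCast,
    sub_self, add_zero, Int.cast_zero]
  norm_num [Fin.sum_univ_four, skewSite, honeycomb_sign_mul_sign_mul hsk, Matrix.cons_val_two,
    Matrix.cons_val_three, Matrix.vecHead, Matrix.vecTail]

end Summit.AtomisticToContinuum.Crystallization.Theorems.HullExactificationCascadeRobustBarlowTemplate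

end
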